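import Literature.Computability.Complexity.ExpanderOps
import Mathlib.Algebra.Field.ZMod
import HarnessLib

/-!
# The affine-plane graphs `AP_q`: an algebraic base expander with an elementary spectral bound (Reingold–Vadhan–Wigderson, §5.1)

The base graphs of the tree's explicit expander family (in place of the brute-force base graphs of
Arora–Barak 2009, Thm. 21.19): for a prime `q`, the graph `AP_q` on the `q²` vertices
`ZMod q × ZMod q` in which the `c`-th neighbour of `(a, b)` is `(c, a c - b)` — the point–line
incidence structure of the affine plane folded onto one vertex set ("the vertex `(a, b)` is
adjacent to all points of the line `y = a x - b`", Reingold–Vadhan–Wigderson 2002, §5.1, who note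
`λ(AP_q) = 1/√q`).  The rotation map `((a,b), c) ↦ ((c, ac - b), a)` is an involution, and the
spectral bound has a two-line proof by counting: two vertices with distinct first coordinates have
exactly one common neighbour, two distinct vertices with equal first coordinates have none, so

`‖M v‖² = q ‖v‖² + (∑ v)² - ∑_c (∑_d v(c,d))² ≤ q ‖v‖²` for `∑ v = 0`

(`M = q ·` walk matrix), i.e. `SpectralBound (walkMatrix AP_q) (1/√q)` in the sense of
`ExpanderMixing.lean`.

* `AffinePlane.graph q : RotGraph (q * q) q`, `nbr_eq`;
* `RotGraph.walkMatrix_mulVec` — `(A v)(u) = (1/d) ∑ᵢ v(nbr u i)` (general);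
* `sum_sq_lineSum_eq` — the counting identity; **`spectralBound_graph`** — `λ(AP_q) ≤ 1/√q`.

## References

* O. Reingold, S. Vadhan, A. Wigderson, *Entropy waves, the zig-zag graph product, and new
  constant-degree expanders*, Ann. of Math. 155 (2002), §5.1 (the affine plane base graph).
* S. Arora, B. Barak, *Computational Complexity: A Modern Approach*, CUP 2009, §21.3.5 (base graphs
  of the explicit construction).
-/

noncomputable section

namespace Literature.Computability.Complexity

open Finset Matrix

namespace Expander

namespace RotGraph

variable {n d : ℕ} (G : RotGraph n d)

/-- **The walk matrix acts by averaging over neighbours**: `(A v)(u) = (1/d) ∑ᵢ v(nbr u i)`. [cite: AroraBarakCC2009, §21.1 (random-walk matrix)] -/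
theorem walkMatrix_mulVec (v : Fin n → ℝ) (u : Fin n) : (G.walkMatrix *ᵥ v) u = (∑ i, v (G.nbr u i)) / d := by
  classical
  -- `∑_w #{i | nbr u i = w} v w = ∑_i v (nbr u i)`
  have key : ∑ w, (((univ.filter fun i : Fin d => G.nbr u i = w).card : ℕ) : ℝ) * v w = ∑ i, v (G.nbr u i) := by
    rw [← sum_fiberwise_of_maps_to (g := fun i : Fin d => G.nbr u i) (s := univ) (t := univ) (fun i _ => mem_univ _)
      (fun i => v (G.nbr u i))]
    refine sum_congr rfl fun w _ => ?_
    rw [card_eq_sum_ones, Nat.cast_sum, sum_mul]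
    exact sum_congr rfl fun i hi => by rw [(mem_filter.1 hi).2, Nat.cast_one, one_mul]
  simp only [mulVec, dotProduct, walkMatrix_apply, pathCount_one]
  rw [← key, sum_div]
  exact sum_congr rfl fun w _ => by ring

end RotGraph

namespace AffinePlane

variable (q : ℕ) [hq : Fact q.Prime]

/-- A prime is nonzero. [folklore] -/
instance neZero : NeZero q := ⟨hq.out.ne_zero⟩

/-- Vertices of `AP_q` as pairs over `ZMod q`. [folklore] -/
def vert : Fin (q * q) ≃ ZMod q × ZMod q :=
  finProdFinEquiv.symm.trans (Equiv.prodCongr (ZMod.finEquiv q).toEquiv (ZMod.finEquiv q).toEquiv)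

/-- Edge labels of `AP_q` as elements of `ZMod q`. [folklore] -/
def lab : Fin q ≃ ZMod q := (ZMod.finEquiv q).toEquiv

/-- The rotation map `((a, b), c) ↦ ((c, a c - b), a)`. [cite: ReingoldVadhanWigderson2002, §5.1] -/
def apRot (x : Fin (q * q) × Fin q) : Fin (q * q) × Fin q :=
  ((vert q).symm (lab q x.2, (vert q x.1).1 * lab q x.2 - (vert q x.1).2), (lab q).symm (vert q x.1).1)

/-- The rotation map is an involution: from `(c, ac - b)` the `a`-th neighbour is `(a, c a - (a c - b)) = (a, b)`. [cite: ReingoldVadhanWigderson2002, §5.1] -/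
theorem apRot_apRot (x : Fin (q * q) × Fin q) : apRot q (apRot q x) = x := by
  obtain ⟨v, i⟩ := x
  unfold apRot
  simp only [Equiv.apply_symm_apply]
  refine Prod.ext ?_ ?_
  · simp only
    conv_rhs => rw [← (vert q).symm_apply_apply v]
    congr 1
    ext <;> simp only; ring
  · simp only [Equiv.symm_apply_apply]

/-- **The graph `AP_q`** (`q²` vertices, `q`-regular). [cite: ReingoldVadhanWigderson2002, §5.1] -/
def graph : RotGraph (q * q) q := ⟨apRot q, apRot_apRot q⟩

/-- The neighbours of `(a, b)`: the `c`-th one is `(c, a c - b)`. [cite: ReingoldVadhanWigderson2002, §5.1] -/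
theorem vert_nbr (x : Fin (q * q)) (i : Fin q) :
    vert q ((graph q).nbr x i) = (lab q i, (vert q x).1 * lab q i - (vert q x).2) := by
  show vert q (apRot q (x, i)).1 = _
  unfold apRot
  simp only [Equiv.apply_symm_apply]

/-! ### The counting identity -/

/-- The line sums `L f (a, b) = ∑_c f(c, a c - b)` (`= q · (A v)(a,b)`). [folklore] -/
def lineSum (f : ZMod q × ZMod q → ℝ) (p : ZMod q × ZMod q) : ℝ := ∑ c, f (c, p.1 * c - p.2)

/-- The row sums `R f c = ∑_d f(c, d)`. [folklore] -/
def rowSum (f : ZMod q × ZMod q → ℝ) (c : ZMod q) : ℝ := ∑ d, f (c, d)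

/-- **The counting identity**: `∑_p (L f p)² = q ∑ f² + (∑_c R_c)² - ∑_c R_c²` (two vertices with
different first coordinates have exactly one common neighbour, with equal first coordinates none).
[cite: ReingoldVadhanWigderson2002, §5.1 (λ(AP_q) = 1/√q)] -/
theorem sum_sq_lineSum_eq (f : ZMod q × ZMod q → ℝ) :
    ∑ p, lineSum q f p ^ 2 = q * ∑ p, f p ^ 2 + (∑ c, rowSum q f c) ^ 2 - ∑ c, rowSum q f c ^ 2 := by
  have hqcard : Fintype.card (ZMod q) = q := ZMod.card q
  -- expand the square and substitute `b ↦ d = a c - b`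
  have h1 : ∀ a : ZMod q, ∑ b, lineSum q f (a, b) ^ 2 = ∑ c, ∑ c', ∑ d, f (c, d) * f (c', d + a * (c' - c)) := by
    intro a
    simp only [lineSum, sq, sum_mul_sum]
    rw [sum_comm]
    refine sum_congr rfl fun c _ => ?_
    rw [sum_comm]
    refine sum_congr rfl fun c' _ => ?_
    -- `∑_b f(c, ac - b) f(c', ac' - b) = ∑_d f(c,d) f(c', d + a(c'-c))`
    refine Fintype.sum_equiv (Equiv.subLeft (a * c)) _ _ fun b => ?_
    simp only [Equiv.subLeft_apply]
    congr 2
    simp only [Prod.mk.injEq, true_and]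
    ring
  -- sum over `a`: diagonal `c = c'` gives `q f(c,d)²`, off-diagonal gives `R c · R c'`
  have h2 : ∀ (c c' : ZMod q) (d : ZMod q), c ≠ c' → ∑ a, f (c', d + a * (c' - c)) = rowSum q f c' := by
    intro c c' d hne
    unfold rowSum
    have hunit : (c' - c) ≠ 0 := sub_ne_zero.2 (Ne.symm hne)
    refine Fintype.sum_equiv ((Equiv.mulRight₀ (c' - c) hunit).trans (Equiv.addLeft d)) _ _ fun a => ?_
    simp
  rw [Fintype.sum_prod_type]
  simp only [h1]
  -- reorder to `∑ c, ∑ c', ∑ d, ∑ a`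
  rw [sum_comm]
  simp only [sum_comm (s := (univ : Finset (ZMod q))) (f := fun a c' => ∑ d, f (_, d) * f (c', d + a * (c' - _)))]
  have h3 : ∀ c c' : ZMod q, ∑ a, ∑ d, f (c, d) * f (c', d + a * (c' - c)) =
      if c = c' then q * ∑ d, f (c, d) ^ 2 else rowSum q f c * rowSum q f c' := by
    intro c c'
    rw [sum_comm]
    split_ifs with h
    · subst h
      simp only [sub_self, mul_zero, add_zero, sum_const, card_univ, hqcard, nsmul_eq_mul, sq]
      rw [mul_sum]
    · rw [rowSum, sum_mul]
      refine sum_congr rfl fun d _ => ?_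
      rw [← mul_sum, h2 c c' d h]
  simp only [h3]
  -- `∑ c, ∑ c', ite = q ∑ f² + ∑_{c ≠ c'} R c R c'`
  have h4 : ∀ c : ZMod q, ∑ c', (if c = c' then (q : ℝ) * ∑ d, f (c, d) ^ 2 else rowSum q f c * rowSum q f c') =
      q * ∑ d, f (c, d) ^ 2 + (rowSum q f c * ∑ c', rowSum q f c' - rowSum q f c ^ 2) := by
    intro c
    rw [← Finset.sum_erase_add _ _ (mem_univ c), if_pos rfl, add_comm]
    congr 1
    rw [sum_congr rfl fun c' hc' => if_neg (Ne.symm (ne_of_mem_erase hc')), ← mul_sum, Finset.sum_erase_eq_sub (mem_univ c)]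
    ring
  simp only [h4, sum_add_distrib, sum_sub_distrib, ← mul_sum, ← sum_mul]
  rw [Fintype.sum_prod_type, sq (∑ c, rowSum q f c)]
  ring

/-- **`λ(AP_q) ≤ 1/√q`**: for `∑ v = 0`, `‖A v‖² ≤ (1/q) ‖v‖²`. [cite: ReingoldVadhanWigderson2002, §5.1] -/
theorem spectralBound_graph : SpectralBound (graph q).walkMatrix (1 / Real.sqrt q) := by
  have hqpos : (0 : ℝ) < q := by exact_mod_cast hq.out.pos
  refine ⟨by positivity, fun v hv => ?_⟩
  rw [div_pow, one_pow, Real.sq_sqrt hqpos.le]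
  -- transport to `ZMod q × ZMod q`
  set f : ZMod q × ZMod q → ℝ := fun p => v ((vert q).symm p) with hf
  have hAv : ∀ u, ((graph q).walkMatrix *ᵥ v) u = lineSum q f (vert q u) / q := by
    intro u
    rw [RotGraph.walkMatrix_mulVec, lineSum]
    congr 1
    refine Fintype.sum_equiv (lab q) _ _ fun i => ?_
    rw [hf]
    simp only
    rw [← vert_nbr, Equiv.symm_apply_apply]
  have hnorm : ((graph q).walkMatrix *ᵥ v) ⬝ᵥ ((graph q).walkMatrix *ᵥ v) = (∑ p, lineSum q f p ^ 2) / q ^ 2 := by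
    simp only [dotProduct, hAv]
    rw [sum_div]
    refine (Fintype.sum_equiv (vert q) _ _ fun u => ?_)
    ring
  have hvv : v ⬝ᵥ v = ∑ p, f p ^ 2 := by
    simp only [dotProduct, hf, ← sq]
    exact (Fintype.sum_equiv (vert q).symm _ _ fun p => rfl).symm.trans (by rw [Equiv.sum_comp]) |>.symm.trans
      ((Fintype.sum_equiv (vert q) _ _ fun u => by simp))
  have hsum : ∑ c, rowSum q f c = 0 := by
    unfold rowSum
    rw [← Fintype.sum_prod_type, ← hv]
    exact Fintype.sum_equiv (vert q).symm _ _ fun p => rfl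
  rw [hnorm, hvv, sum_sq_lineSum_eq, hsum]
  rw [div_le_iff₀ (by positivity)]
  have hR : 0 ≤ ∑ c, rowSum q f c ^ 2 := sum_nonneg fun c _ => sq_nonneg _
  have hF : 0 ≤ ∑ p, f p ^ 2 := sum_nonneg fun p _ => sq_nonneg _
  field_simp
  nlinarith

end AffinePlane

end Expander

end Literature.Computability.Complexity

end
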